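import Summits.FinalStateConjecture.FinalStateConjecture.Theorems.KerrnessPropagatesKillingSpinorEndgameLatenessIdle

/-!
# `SingleKerrEndgame` (item stmt-FinalStateConjecture-17647) — what the crux already gives
# (T2 text: re-threaded 2026-08-17 for the re-typed crux stmt-17645 / support item stmt-17647, route rev ≥ 11)

Support lemmas for the route `KerrnessPropagates`: the N = 1 support item `SingleKerrEndgame`
(future-oriented recurrence of an MGHD to ONE fixed sub-extremal boosted Kerr plus the interior lemma ⇒
exhaustive, future-oriented, ray-closed one-hole `C²` decomposition) versus the crux `KillingSpinorEndgame`
(same with `N` holes, `Fin N`-indexed). SUPERSEDES `Theorems/KerrnessPropagatesSingleKerrEndgame.lean`, whose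
lemmas (namespace `…Theorems`, same short names) were written for the pre-T2 items (stmt-11009 / stmt-11032) and
stopped elaborating when both were re-typed (future-oriented slab clause, interior-lemma hypothesis,
`RaysStayInClosure ∧ IsFutureOriented` conjuncts; `lean check` 2026-08-17: rc 1); Theorems files being append-only,
the re-threaded lemmas (the route file's rev-11 note: "mechanical") live here, in namespace
`…Theorems.KerrnessPropagates`, and the stale file awaits deprecation by its owner.

* `one_hole_recurrence_to_fin_one` — the scalar (one-hole) recurrence hypothesis of `SingleKerrEndgame` at
  regularity `k` implies the `Fin 1`-indexed recurrence hypothesis of `KillingSpinorEndgame` at the same `k`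
  (written with `SlabClauses`, p152635: the two near zones coincide; the crux's far zone
  `{x⁰ = τ, r₀ < r, R − 1 ≤ r}` is contained in the item's `{x⁰ = τ, R − 1 ≤ r}`; the orientation clauses agree).
* `singleKerrEndgame_weak_of_killingSpinorEndgame` — hence the crux settles the support item up to the hole
  count: `KillingSpinorEndgame` implies `SingleKerrEndgame` with the conjunct `d.N = 1` deleted.
* `singleKerrEndgame_weak_of_singleKerrEndgame` — `SingleKerrEndgame` implies the same weak form.
* `one_hole_recurrence_anti`, `singleKerrEndgame_at_mono` — the recurrence hypothesis is antitone in the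
  regularity `k` (`supCkENorm_mono_right`), so the regularities at which the item's implication holds are
  upward closed: its leading `∃ k` means "for all sufficiently large `k`".
Nothing here is deep (pure logic over the route file's definitions); the item itself — a recurrence-to-convergence
theorem containing sub-extremal Kerr asymptotic stability — is not touched.
-/

open Literature.Geometry.Lorentzian
open scoped Manifold ContDiff Topology ENNReal
open Set TopologicalSpace

-- every `Summit.FinalStateConjecture.FinalStateConjecture.…` name repeats the summit = sub-problem
-- segment (D-0017 layout, CONVENTIONS §2); the duplicate is deliberate.
set_option linter.dupNamespace false

namespace Summit.FinalStateConjecture.FinalStateConjecture.Theorems.KerrnessPropagates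

open Summit.FinalStateConjecture.FinalStateConjecture.Theses.KerrnessPropagates

/-- **One-hole recurrence is `Fin 1`-recurrence.** The recurrence hypothesis of the support item
`SingleKerrEndgame` (scalar parameters `(M, a, r₀)`, one motion `mo`, future-oriented far zone) for a
development `𝒟` at regularity `k` implies the recurrence hypothesis (clause (i), `SlabClauses` form) of the
crux `KillingSpinorEndgame` with `N = 1` (constant families `fun _ ↦ M`, …): the near-zone sets coincide, the
crux's far-zone set is a subset of the item's (`supCkENorm_mono`), and the crux's orientation clause asks the
item's at the same points. [folklore] -/
theorem one_hole_recurrence_to_fin_one {k : ℕ} {X : Type} [TopologicalSpace X] [ChartedSpace E3 X]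
    [IsManifold (𝓡 3) ∞ X] [ConnectedSpace X] {D : InitialDataSet (𝓡 3) X}
    (𝒟 : VacuumCauchyDevelopment D)
    (h : ∃ (M a r₀ : ℝ) (mo : ↥lorentzGroup × E4),
      (Kerr.IsSubextremal M a ∧ r₀ ∈ Ioo (Kerr.rMinus M a) (Kerr.rPlus M a)) ∧
      ∀ ε : ℝ, 0 < ε → ∀ τ₁ : ℝ, ∃ τ : ℝ, τ₁ ≤ τ ∧
        ∃ (R : ℝ) (U : Opens E4) (Φ : U → 𝒟.carrier), r₀ + 1 ≤ R ∧
          ContMDiff 𝓘(ℝ, E4) (𝓡 4) ∞ Φ ∧ Topology.IsOpenEmbedding Φ ∧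
          {x : E4 | x 0 = τ ∧ r₀ < Kerr.radius a (poincareInv mo.1 mo.2 x)} ⊆ (U : Set E4) ∧
          range Φ ⊆ 𝒟.metric.causalFuture 𝒟.timeOrientation (range 𝒟.embed) ∧
          𝒟.metric.IsAchronal 𝒟.timeOrientation (Φ '' {x : ↥U | (x : E4) 0 = τ}) ∧
          supCkENorm {x : E4 | x 0 = τ ∧ r₀ < Kerr.radius a (poincareInv mo.1 mo.2 x) ∧
              Kerr.radius a (poincareInv mo.1 mo.2 x) ≤ R} k
            (𝒟.toSpacetime.deviationExtend ⟨U, boostedKerrBilin mo.1 mo.2 M a, fun x ↦ x 0,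
              fun x ↦ Kerr.radius a (poincareInv mo.1 mo.2 x)⟩ Φ) ≤ ENNReal.ofReal ε ∧
          supCkENorm {x : E4 | x 0 = τ ∧ R - 1 ≤ Kerr.radius a (poincareInv mo.1 mo.2 x)} k
            (𝒟.toSpacetime.deviationExtend (Minkowski.backgroundOn U) Φ) ≤ ENNReal.ofReal ε ∧
          (∀ x : ↥U, x.1 0 = τ → R - 1 ≤ Kerr.radius a (poincareInv mo.1 mo.2 x.1) →
            𝒟.timeOrientation.IsFutureDirected
              (mfderiv 𝓘(ℝ, E4) (𝓡 4) Φ x (E4.basisVector 0)))) :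
    ∃ (N : ℕ) (M a r₀ : Fin N → ℝ) (mo : Fin N → ↥lorentzGroup × E4),
      (∀ i, Kerr.IsSubextremal (M i) (a i) ∧
        r₀ i ∈ Ioo (Kerr.rMinus (M i) (a i)) (Kerr.rPlus (M i) (a i))) ∧
      ∀ ε : ℝ, 0 < ε → ∀ τ₁ : ℝ, ∃ τ : ℝ, τ₁ ≤ τ ∧
        ∃ (R : Fin N → ℝ) (U : Opens E4) (Φ : U → 𝒟.carrier),
          SlabClauses 𝒟 k N M a r₀ mo ε τ R U Φ := by
  obtain ⟨M, a, r₀, mo, hsub, hrec⟩ := h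
  refine ⟨1, fun _ ↦ M, fun _ ↦ a, fun _ ↦ r₀, fun _ ↦ mo, fun _ ↦ hsub, fun ε hε τ₁ ↦ ?_⟩
  obtain ⟨τ, hτ, R, U, Φ, hR, hsmooth, hemb, hU, hJ, hachr, hnear, hfar, hfd⟩ := hrec ε hε τ₁
  refine ⟨τ, hτ, fun _ ↦ R, U, Φ, fun _ ↦ hR, hsmooth, hemb, ?_, hJ, hachr, fun _ ↦ ?_, ?_, ?_⟩
  · simpa only [Fin.forall_fin_one] using hU
  · simpa only [Fin.forall_fin_one] using hnear
  · refine le_trans (supCkENorm_mono (fun x hx ↦ ?_) _ _) hfar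
    simp only [Fin.forall_fin_one, mem_setOf_eq] at hx ⊢
    exact ⟨hx.1, hx.2.2⟩
  · intro x hx0 hxR
    exact hfd x hx0 (hxR 0)

/-- **The crux settles the support item up to the hole count.** `KillingSpinorEndgame` (crux,
stmt-FinalStateConjecture-17645) implies `SingleKerrEndgame` (support, stmt-FinalStateConjecture-17647) with the
single conjunct `d.N = 1` removed from its conclusion: a development recurring (future-oriented) to one fixed
sub-extremal boosted Kerr recurs, in the crux's `Fin N`-indexed sense, to the one-element configuration
(`one_hole_recurrence_to_fin_one`), so — given the interior lemma — the crux yields an exhaustive,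
future-oriented, ray-closed `C²` decomposition of the self-determined exterior with sub-extremal holes, of
unspecified number `d.N`. [folklore] -/
theorem singleKerrEndgame_weak_of_killingSpinorEndgame (h : KillingSpinorEndgame) :
    ∃ k : ℕ, ∀ (X : Type) [TopologicalSpace X] [ChartedSpace E3 X] [IsManifold (𝓡 3) ∞ X]
      [T2Space X] [SecondCountableTopology X] [ConnectedSpace X] (D : InitialDataSet (𝓡 3) X),
      D ∈ admissibleVacuumData X → ∀ 𝒟 : VacuumCauchyDevelopment D, 𝒟.IsMaximal →
      Summit.FinalStateConjecture.HasCompleteNullInfinity 𝒟.toCauchyDevelopment →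
      (∃ (M a r₀ : ℝ) (mo : ↥lorentzGroup × E4),
        (Kerr.IsSubextremal M a ∧ r₀ ∈ Ioo (Kerr.rMinus M a) (Kerr.rPlus M a)) ∧
        ∀ ε : ℝ, 0 < ε → ∀ τ₁ : ℝ, ∃ τ : ℝ, τ₁ ≤ τ ∧
          ∃ (R : ℝ) (U : Opens E4) (Φ : U → 𝒟.carrier), r₀ + 1 ≤ R ∧
            ContMDiff 𝓘(ℝ, E4) (𝓡 4) ∞ Φ ∧ Topology.IsOpenEmbedding Φ ∧
            {x : E4 | x 0 = τ ∧ r₀ < Kerr.radius a (poincareInv mo.1 mo.2 x)} ⊆ (U : Set E4) ∧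
            range Φ ⊆ 𝒟.metric.causalFuture 𝒟.timeOrientation (range 𝒟.embed) ∧
            𝒟.metric.IsAchronal 𝒟.timeOrientation (Φ '' {x : ↥U | (x : E4) 0 = τ}) ∧
            supCkENorm {x : E4 | x 0 = τ ∧ r₀ < Kerr.radius a (poincareInv mo.1 mo.2 x) ∧
                Kerr.radius a (poincareInv mo.1 mo.2 x) ≤ R} k
              (𝒟.toSpacetime.deviationExtend ⟨U, boostedKerrBilin mo.1 mo.2 M a, fun x ↦ x 0,
                fun x ↦ Kerr.radius a (poincareInv mo.1 mo.2 x)⟩ Φ) ≤ ENNReal.ofReal ε ∧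
            supCkENorm {x : E4 | x 0 = τ ∧ R - 1 ≤ Kerr.radius a (poincareInv mo.1 mo.2 x)} k
              (𝒟.toSpacetime.deviationExtend (Minkowski.backgroundOn U) Φ) ≤ ENNReal.ofReal ε ∧
            (∀ x : ↥U, x.1 0 = τ → R - 1 ≤ Kerr.radius a (poincareInv mo.1 mo.2 x.1) →
              𝒟.timeOrientation.IsFutureDirected
                (mfderiv 𝓘(ℝ, E4) (𝓡 4) Φ x (E4.basisVector 0)))) →
      (∀ (O : Set 𝒟.carrier) (d : FinalStateDecomposition 𝒟.toSpacetime O 2),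
        (∀ i, Kerr.IsSubextremal (d.mass i) (d.spin i)) →
        O = Summit.FinalStateConjecture.exteriorOf 𝒟.toCauchyDevelopment d.charted →
        Summit.FinalStateConjecture.HasExhaustiveCharts d →
        Summit.FinalStateConjecture.IsFutureOriented d →
        Summit.FinalStateConjecture.RaysStayInClosure 𝒟.toCauchyDevelopment O) →
      ∃ (O : Set 𝒟.carrier) (d : FinalStateDecomposition 𝒟.toSpacetime O 2),
        (∀ i, Kerr.IsSubextremal (d.mass i) (d.spin i)) ∧
        O = Summit.FinalStateConjecture.exteriorOf 𝒟.toCauchyDevelopment d.charted ∧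
        Summit.FinalStateConjecture.RaysStayInClosure 𝒟.toCauchyDevelopment O ∧
        Summit.FinalStateConjecture.HasExhaustiveCharts d ∧
        Summit.FinalStateConjecture.IsFutureOriented d := by
  rw [killingSpinorEndgame_iff] at h
  obtain ⟨k, hk⟩ := h
  refine ⟨k, fun X _ _ _ _ _ _ D hD 𝒟 hmax hscri hrec ↦ ?_⟩
  exact hk X D hD 𝒟 hmax hscri (one_hole_recurrence_to_fin_one 𝒟 hrec)

/-- **`SingleKerrEndgame` itself implies its weak form** (drop `d.N = 1`), so the two statements
`SingleKerrEndgame` and `KillingSpinorEndgame` meet in the weak form. [folklore] -/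
theorem singleKerrEndgame_weak_of_singleKerrEndgame (h : SingleKerrEndgame) :
    ∃ k : ℕ, ∀ (X : Type) [TopologicalSpace X] [ChartedSpace E3 X] [IsManifold (𝓡 3) ∞ X]
      [T2Space X] [SecondCountableTopology X] [ConnectedSpace X] (D : InitialDataSet (𝓡 3) X),
      D ∈ admissibleVacuumData X → ∀ 𝒟 : VacuumCauchyDevelopment D, 𝒟.IsMaximal →
      Summit.FinalStateConjecture.HasCompleteNullInfinity 𝒟.toCauchyDevelopment →
      (∃ (M a r₀ : ℝ) (mo : ↥lorentzGroup × E4),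
        (Kerr.IsSubextremal M a ∧ r₀ ∈ Ioo (Kerr.rMinus M a) (Kerr.rPlus M a)) ∧
        ∀ ε : ℝ, 0 < ε → ∀ τ₁ : ℝ, ∃ τ : ℝ, τ₁ ≤ τ ∧
          ∃ (R : ℝ) (U : Opens E4) (Φ : U → 𝒟.carrier), r₀ + 1 ≤ R ∧
            ContMDiff 𝓘(ℝ, E4) (𝓡 4) ∞ Φ ∧ Topology.IsOpenEmbedding Φ ∧
            {x : E4 | x 0 = τ ∧ r₀ < Kerr.radius a (poincareInv mo.1 mo.2 x)} ⊆ (U : Set E4) ∧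
            range Φ ⊆ 𝒟.metric.causalFuture 𝒟.timeOrientation (range 𝒟.embed) ∧
            𝒟.metric.IsAchronal 𝒟.timeOrientation (Φ '' {x : ↥U | (x : E4) 0 = τ}) ∧
            supCkENorm {x : E4 | x 0 = τ ∧ r₀ < Kerr.radius a (poincareInv mo.1 mo.2 x) ∧
                Kerr.radius a (poincareInv mo.1 mo.2 x) ≤ R} k
              (𝒟.toSpacetime.deviationExtend ⟨U, boostedKerrBilin mo.1 mo.2 M a, fun x ↦ x 0,
                fun x ↦ Kerr.radius a (poincareInv mo.1 mo.2 x)⟩ Φ) ≤ ENNReal.ofReal ε ∧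
            supCkENorm {x : E4 | x 0 = τ ∧ R - 1 ≤ Kerr.radius a (poincareInv mo.1 mo.2 x)} k
              (𝒟.toSpacetime.deviationExtend (Minkowski.backgroundOn U) Φ) ≤ ENNReal.ofReal ε ∧
            (∀ x : ↥U, x.1 0 = τ → R - 1 ≤ Kerr.radius a (poincareInv mo.1 mo.2 x.1) →
              𝒟.timeOrientation.IsFutureDirected
                (mfderiv 𝓘(ℝ, E4) (𝓡 4) Φ x (E4.basisVector 0)))) →
      (∀ (O : Set 𝒟.carrier) (d : FinalStateDecomposition 𝒟.toSpacetime O 2),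
        (∀ i, Kerr.IsSubextremal (d.mass i) (d.spin i)) →
        O = Summit.FinalStateConjecture.exteriorOf 𝒟.toCauchyDevelopment d.charted →
        Summit.FinalStateConjecture.HasExhaustiveCharts d →
        Summit.FinalStateConjecture.IsFutureOriented d →
        Summit.FinalStateConjecture.RaysStayInClosure 𝒟.toCauchyDevelopment O) →
      ∃ (O : Set 𝒟.carrier) (d : FinalStateDecomposition 𝒟.toSpacetime O 2),
        (∀ i, Kerr.IsSubextremal (d.mass i) (d.spin i)) ∧
        O = Summit.FinalStateConjecture.exteriorOf 𝒟.toCauchyDevelopment d.charted ∧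
        Summit.FinalStateConjecture.RaysStayInClosure 𝒟.toCauchyDevelopment O ∧
        Summit.FinalStateConjecture.HasExhaustiveCharts d ∧
        Summit.FinalStateConjecture.IsFutureOriented d := by
  obtain ⟨k, hk⟩ := h
  refine ⟨k, fun X _ _ _ _ _ _ D hD 𝒟 hmax hscri hrec hint ↦ ?_⟩
  obtain ⟨O, d, -, hsub, hO, hrays, hex, hfo⟩ := hk X D hD 𝒟 hmax hscri hrec hint
  exact ⟨O, d, hsub, hO, hrays, hex, hfo⟩

/-- **Recurrence is antitone in the regularity.** The one-hole recurrence hypothesis of `SingleKerrEndgame`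
for a development `𝒟` at regularity `k'` implies it at every `k ≤ k'`: the two `Cᵏ` sup norms are monotone in
`k` (`supCkENorm_mono_right`), everything else is unchanged. [folklore] -/
theorem one_hole_recurrence_anti {k k' : ℕ} (hk : k ≤ k') {X : Type} [TopologicalSpace X]
    [ChartedSpace E3 X] [IsManifold (𝓡 3) ∞ X] [ConnectedSpace X] {D : InitialDataSet (𝓡 3) X}
    (𝒟 : VacuumCauchyDevelopment D)
    (h : ∃ (M a r₀ : ℝ) (mo : ↥lorentzGroup × E4),
      (Kerr.IsSubextremal M a ∧ r₀ ∈ Ioo (Kerr.rMinus M a) (Kerr.rPlus M a)) ∧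
      ∀ ε : ℝ, 0 < ε → ∀ τ₁ : ℝ, ∃ τ : ℝ, τ₁ ≤ τ ∧
        ∃ (R : ℝ) (U : Opens E4) (Φ : U → 𝒟.carrier), r₀ + 1 ≤ R ∧
          ContMDiff 𝓘(ℝ, E4) (𝓡 4) ∞ Φ ∧ Topology.IsOpenEmbedding Φ ∧
          {x : E4 | x 0 = τ ∧ r₀ < Kerr.radius a (poincareInv mo.1 mo.2 x)} ⊆ (U : Set E4) ∧
          range Φ ⊆ 𝒟.metric.causalFuture 𝒟.timeOrientation (range 𝒟.embed) ∧
          𝒟.metric.IsAchronal 𝒟.timeOrientation (Φ '' {x : ↥U | (x : E4) 0 = τ}) ∧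
          supCkENorm {x : E4 | x 0 = τ ∧ r₀ < Kerr.radius a (poincareInv mo.1 mo.2 x) ∧
              Kerr.radius a (poincareInv mo.1 mo.2 x) ≤ R} k'
            (𝒟.toSpacetime.deviationExtend ⟨U, boostedKerrBilin mo.1 mo.2 M a, fun x ↦ x 0,
              fun x ↦ Kerr.radius a (poincareInv mo.1 mo.2 x)⟩ Φ) ≤ ENNReal.ofReal ε ∧
          supCkENorm {x : E4 | x 0 = τ ∧ R - 1 ≤ Kerr.radius a (poincareInv mo.1 mo.2 x)} k'
            (𝒟.toSpacetime.deviationExtend (Minkowski.backgroundOn U) Φ) ≤ ENNReal.ofReal ε ∧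
          (∀ x : ↥U, x.1 0 = τ → R - 1 ≤ Kerr.radius a (poincareInv mo.1 mo.2 x.1) →
            𝒟.timeOrientation.IsFutureDirected
              (mfderiv 𝓘(ℝ, E4) (𝓡 4) Φ x (E4.basisVector 0)))) :
    ∃ (M a r₀ : ℝ) (mo : ↥lorentzGroup × E4),
    (Kerr.IsSubextremal M a ∧ r₀ ∈ Ioo (Kerr.rMinus M a) (Kerr.rPlus M a)) ∧
    ∀ ε : ℝ, 0 < ε → ∀ τ₁ : ℝ, ∃ τ : ℝ, τ₁ ≤ τ ∧
      ∃ (R : ℝ) (U : Opens E4) (Φ : U → 𝒟.carrier), r₀ + 1 ≤ R ∧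
        ContMDiff 𝓘(ℝ, E4) (𝓡 4) ∞ Φ ∧ Topology.IsOpenEmbedding Φ ∧
        {x : E4 | x 0 = τ ∧ r₀ < Kerr.radius a (poincareInv mo.1 mo.2 x)} ⊆ (U : Set E4) ∧
        range Φ ⊆ 𝒟.metric.causalFuture 𝒟.timeOrientation (range 𝒟.embed) ∧
        𝒟.metric.IsAchronal 𝒟.timeOrientation (Φ '' {x : ↥U | (x : E4) 0 = τ}) ∧
        supCkENorm {x : E4 | x 0 = τ ∧ r₀ < Kerr.radius a (poincareInv mo.1 mo.2 x) ∧
            Kerr.radius a (poincareInv mo.1 mo.2 x) ≤ R} k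
          (𝒟.toSpacetime.deviationExtend ⟨U, boostedKerrBilin mo.1 mo.2 M a, fun x ↦ x 0,
            fun x ↦ Kerr.radius a (poincareInv mo.1 mo.2 x)⟩ Φ) ≤ ENNReal.ofReal ε ∧
        supCkENorm {x : E4 | x 0 = τ ∧ R - 1 ≤ Kerr.radius a (poincareInv mo.1 mo.2 x)} k
          (𝒟.toSpacetime.deviationExtend (Minkowski.backgroundOn U) Φ) ≤ ENNReal.ofReal ε ∧
        (∀ x : ↥U, x.1 0 = τ → R - 1 ≤ Kerr.radius a (poincareInv mo.1 mo.2 x.1) →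
          𝒟.timeOrientation.IsFutureDirected
            (mfderiv 𝓘(ℝ, E4) (𝓡 4) Φ x (E4.basisVector 0))) := by
  obtain ⟨M, a, r₀, mo, hsub, hrec⟩ := h
  refine ⟨M, a, r₀, mo, hsub, fun ε hε τ₁ ↦ ?_⟩
  obtain ⟨τ, hτ, R, U, Φ, hR, hsmooth, hemb, hU, hJ, hachr, hnear, hfar, hfd⟩ := hrec ε hε τ₁
  exact ⟨τ, hτ, R, U, Φ, hR, hsmooth, hemb, hU, hJ, hachr, (supCkENorm_mono_right _ hk _).trans hnear,
    (supCkENorm_mono_right _ hk _).trans hfar, hfd⟩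

/-- **The good regularities of `SingleKerrEndgame` are upward closed.** If "future-oriented one-hole
recurrence at regularity `k` and the interior lemma ⇒ exhaustive, future-oriented, ray-closed one-hole `C²`
decomposition" holds for every admissible datum and every MGHD with complete `𝓘⁺`, then so does the same
implication at every `k' ≥ k` (the hypothesis only gets stronger, `one_hole_recurrence_anti`). So the item's
leading `∃ k` reads "for all sufficiently large `k`", and a proof may fix `k` as large as its estimates
require. [folklore] -/
theorem singleKerrEndgame_at_mono {k k' : ℕ} (hk : k ≤ k')
    (h : ∀ (X : Type) [TopologicalSpace X] [ChartedSpace E3 X] [IsManifold (𝓡 3) ∞ X]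
      [T2Space X] [SecondCountableTopology X] [ConnectedSpace X] (D : InitialDataSet (𝓡 3) X),
      D ∈ admissibleVacuumData X → ∀ 𝒟 : VacuumCauchyDevelopment D, 𝒟.IsMaximal →
      Summit.FinalStateConjecture.HasCompleteNullInfinity 𝒟.toCauchyDevelopment →
      (∃ (M a r₀ : ℝ) (mo : ↥lorentzGroup × E4),
        (Kerr.IsSubextremal M a ∧ r₀ ∈ Ioo (Kerr.rMinus M a) (Kerr.rPlus M a)) ∧
        ∀ ε : ℝ, 0 < ε → ∀ τ₁ : ℝ, ∃ τ : ℝ, τ₁ ≤ τ ∧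
          ∃ (R : ℝ) (U : Opens E4) (Φ : U → 𝒟.carrier), r₀ + 1 ≤ R ∧
            ContMDiff 𝓘(ℝ, E4) (𝓡 4) ∞ Φ ∧ Topology.IsOpenEmbedding Φ ∧
            {x : E4 | x 0 = τ ∧ r₀ < Kerr.radius a (poincareInv mo.1 mo.2 x)} ⊆ (U : Set E4) ∧
            range Φ ⊆ 𝒟.metric.causalFuture 𝒟.timeOrientation (range 𝒟.embed) ∧
            𝒟.metric.IsAchronal 𝒟.timeOrientation (Φ '' {x : ↥U | (x : E4) 0 = τ}) ∧
            supCkENorm {x : E4 | x 0 = τ ∧ r₀ < Kerr.radius a (poincareInv mo.1 mo.2 x) ∧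
                Kerr.radius a (poincareInv mo.1 mo.2 x) ≤ R} k
              (𝒟.toSpacetime.deviationExtend ⟨U, boostedKerrBilin mo.1 mo.2 M a, fun x ↦ x 0,
                fun x ↦ Kerr.radius a (poincareInv mo.1 mo.2 x)⟩ Φ) ≤ ENNReal.ofReal ε ∧
            supCkENorm {x : E4 | x 0 = τ ∧ R - 1 ≤ Kerr.radius a (poincareInv mo.1 mo.2 x)} k
              (𝒟.toSpacetime.deviationExtend (Minkowski.backgroundOn U) Φ) ≤ ENNReal.ofReal ε ∧
            (∀ x : ↥U, x.1 0 = τ → R - 1 ≤ Kerr.radius a (poincareInv mo.1 mo.2 x.1) →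
              𝒟.timeOrientation.IsFutureDirected
                (mfderiv 𝓘(ℝ, E4) (𝓡 4) Φ x (E4.basisVector 0)))) →
      (∀ (O : Set 𝒟.carrier) (d : FinalStateDecomposition 𝒟.toSpacetime O 2),
        (∀ i, Kerr.IsSubextremal (d.mass i) (d.spin i)) →
        O = Summit.FinalStateConjecture.exteriorOf 𝒟.toCauchyDevelopment d.charted →
        Summit.FinalStateConjecture.HasExhaustiveCharts d →
        Summit.FinalStateConjecture.IsFutureOriented d →
        Summit.FinalStateConjecture.RaysStayInClosure 𝒟.toCauchyDevelopment O) →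
      ∃ (O : Set 𝒟.carrier) (d : FinalStateDecomposition 𝒟.toSpacetime O 2),
        d.N = 1 ∧ (∀ i, Kerr.IsSubextremal (d.mass i) (d.spin i)) ∧
        O = Summit.FinalStateConjecture.exteriorOf 𝒟.toCauchyDevelopment d.charted ∧
        Summit.FinalStateConjecture.RaysStayInClosure 𝒟.toCauchyDevelopment O ∧
        Summit.FinalStateConjecture.HasExhaustiveCharts d ∧
        Summit.FinalStateConjecture.IsFutureOriented d) :
    ∀ (X : Type) [TopologicalSpace X] [ChartedSpace E3 X] [IsManifold (𝓡 3) ∞ X]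
    [T2Space X] [SecondCountableTopology X] [ConnectedSpace X] (D : InitialDataSet (𝓡 3) X),
    D ∈ admissibleVacuumData X → ∀ 𝒟 : VacuumCauchyDevelopment D, 𝒟.IsMaximal →
    Summit.FinalStateConjecture.HasCompleteNullInfinity 𝒟.toCauchyDevelopment →
    (∃ (M a r₀ : ℝ) (mo : ↥lorentzGroup × E4),
      (Kerr.IsSubextremal M a ∧ r₀ ∈ Ioo (Kerr.rMinus M a) (Kerr.rPlus M a)) ∧
      ∀ ε : ℝ, 0 < ε → ∀ τ₁ : ℝ, ∃ τ : ℝ, τ₁ ≤ τ ∧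
        ∃ (R : ℝ) (U : Opens E4) (Φ : U → 𝒟.carrier), r₀ + 1 ≤ R ∧
          ContMDiff 𝓘(ℝ, E4) (𝓡 4) ∞ Φ ∧ Topology.IsOpenEmbedding Φ ∧
          {x : E4 | x 0 = τ ∧ r₀ < Kerr.radius a (poincareInv mo.1 mo.2 x)} ⊆ (U : Set E4) ∧
          range Φ ⊆ 𝒟.metric.causalFuture 𝒟.timeOrientation (range 𝒟.embed) ∧
          𝒟.metric.IsAchronal 𝒟.timeOrientation (Φ '' {x : ↥U | (x : E4) 0 = τ}) ∧
          supCkENorm {x : E4 | x 0 = τ ∧ r₀ < Kerr.radius a (poincareInv mo.1 mo.2 x) ∧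
              Kerr.radius a (poincareInv mo.1 mo.2 x) ≤ R} k'
            (𝒟.toSpacetime.deviationExtend ⟨U, boostedKerrBilin mo.1 mo.2 M a, fun x ↦ x 0,
              fun x ↦ Kerr.radius a (poincareInv mo.1 mo.2 x)⟩ Φ) ≤ ENNReal.ofReal ε ∧
          supCkENorm {x : E4 | x 0 = τ ∧ R - 1 ≤ Kerr.radius a (poincareInv mo.1 mo.2 x)} k'
            (𝒟.toSpacetime.deviationExtend (Minkowski.backgroundOn U) Φ) ≤ ENNReal.ofReal ε ∧
          (∀ x : ↥U, x.1 0 = τ → R - 1 ≤ Kerr.radius a (poincareInv mo.1 mo.2 x.1) →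
            𝒟.timeOrientation.IsFutureDirected
              (mfderiv 𝓘(ℝ, E4) (𝓡 4) Φ x (E4.basisVector 0)))) →
    (∀ (O : Set 𝒟.carrier) (d : FinalStateDecomposition 𝒟.toSpacetime O 2),
      (∀ i, Kerr.IsSubextremal (d.mass i) (d.spin i)) →
      O = Summit.FinalStateConjecture.exteriorOf 𝒟.toCauchyDevelopment d.charted →
      Summit.FinalStateConjecture.HasExhaustiveCharts d →
      Summit.FinalStateConjecture.IsFutureOriented d →
      Summit.FinalStateConjecture.RaysStayInClosure 𝒟.toCauchyDevelopment O) →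
    ∃ (O : Set 𝒟.carrier) (d : FinalStateDecomposition 𝒟.toSpacetime O 2),
      d.N = 1 ∧ (∀ i, Kerr.IsSubextremal (d.mass i) (d.spin i)) ∧
      O = Summit.FinalStateConjecture.exteriorOf 𝒟.toCauchyDevelopment d.charted ∧
      Summit.FinalStateConjecture.RaysStayInClosure 𝒟.toCauchyDevelopment O ∧
      Summit.FinalStateConjecture.HasExhaustiveCharts d ∧
      Summit.FinalStateConjecture.IsFutureOriented d := by
  intro X _ _ _ _ _ _ D hD 𝒟 hmax hscri hrec
  exact h X D hD 𝒟 hmax hscri (one_hole_recurrence_anti hk 𝒟 hrec)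

end Summit.FinalStateConjecture.FinalStateConjecture.Theorems.KerrnessPropagates
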